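import Literature.IUT.HodgeArakelov.AbsTopInterfaces
import Literature.IUT.HodgeArakelov.AbsTopQuotientMaps
import Literature.IUT.HodgeArakelov.KummerStructures

/-!
# [IUTchII] §1, Example 1.8 (v): the radial environment `(Π ↷ M^μ_TM(Π), G ↷ O^{×μ}(G), α_{μ,×μ})` — proofs

Mochizuki, *Inter-universal Teichmüller theory II*, §1, Example 1.8 (v), kurims manuscript (Dec. 2020)
p. 39 l. 26 – p. 40 l. 19 [claim: Mochizuki2012, status: disputed] (IUTchII §1 Ex 1.8 (v), kurims pp.39-40).
Record-only typing under the claim key `Mochizuki2012` (D-0012, disputed). PROOF-ONLY companion (abc-iut cell,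
cone row `IUTchII:Ex1.8(v)`; no new definition, no named fact) of the landed statement files
`RadialExamples.lean` (environments; Ex. 1.8 (iv)–(ix) have the SHAPE `ex18iii S Γ`) and
`AbsTopInterfaces.lean` (the [AbsTopIII] output data as the interface `AbsTopMonoids`).

Printed text of (v) (p. 39 l. 26 – p. 40 l. 19): "We define a collection of radial data
`(Π ↷ M^μ_TM(Π), G ↷ O^{×μ}(G), α_{μ,×μ})` to consist of the output data of the first algorithm of `(*μ)` …, the
output data of the second algorithm of `(*×μ)` …, and the poly-morphism … `α_{μ,×μ} : (Π ↷ M^μ_TM(Π)) →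
(G ↷ O^{×μ}(G))|_Π` determined by the full poly-isomorphism `Π/Δ ≅ G` [cf. (i)] and the trivial homomorphism
`M^μ_TM(Π) → O^{×μ}(G)` — i.e., the composite of the natural homomorphisms `M^μ_TM(Π) ⊆ M^×_TM(Π) ≅ O^×(G) ↠
O^{×μ}(G)` [where the `≅` arises from the poly-isomorphism `α_×` of (iii)]. An isomorphism of collections of
radial data … is defined to consist of the isomorphism … `(Π ↷ M^μ_TM(Π)) ≅ (Π* ↷ M^μ_TM(Π*))` induced by an
isomorphism of topological groups `Π ≅ Π*`, together with a `Γ^{×μ}`-multiple of the isomorphism …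
`(G ↷ O^{×μ}(G)) ≅ (G* ↷ O^{×μ}(G*))` induced by an isomorphism of topological groups `G ≅ G*` [so one verifies
immediately that these isomorphisms are compatible with `α_{μ,×μ}`, `α*_{μ,×μ}` in the evident sense]. A
collection of coric data is defined to be the output data of the second algorithm of `(*×μ)` …; an isomorphism
of collections of coric data is defined to be a `Γ^{×μ}`-multiple of the isomorphism … [That is to say, the
definition of the coric data is the same as in the co-cyclotomic version discussed in (iv).] The radial
algorithm is the algorithm given by the assignment `(Π ↷ M^μ_TM(Π), G ↷ O^{×μ}(G), α_{μ,×μ}) ↦ (G ↷ O^{×μ}(G))` —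
whose associated radial functor is full and essentially surjective, hence determines a multiradial
environment."

Dictionary (interface `A : AbsTopMonoids S` of `AbsTopInterfaces.lean`): `M^×_TM(Π) = (A.MTM Π)ˣ`,
`M^μ_TM(Π) = CommGroup.torsion (A.MTM Π)ˣ` (cf. `AbsTopMonoids.Mxmu`), `O^×(G) = A.Ounits G`, `O^μ(G) = A.Omu G`,
`O^{×μ}(G) = A.Oxmu G`; a representative of `α_×` at the level of units is `Units.map` of the tautological
isomorphism `(*TM⊳)` `A.tauto Π : M_TM(Π) ≅ O^⊳(Π/Δ)` followed by the isomorphism `A.mapOtri f` induced by a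
member `f : Π/Δ ≅ G` of the full poly-isomorphism; the `Γ^{×μ}`-multiples act through `A.actIsm G`; the
isomorphism `O^{×μ}(G) ≅ O^{×μ}(G*)` induced by `g : G ≅ G*` is `MulEquivModTorsion (Units.mapEquiv (A.mapOtri g))`.

PROVED here (the three printed claims of (v)):
* (a) `AbsTopMonoids.ex18v_comp_eq_one` / `ex18v_trivialHom` / `ex18v_trivialHom_apply` — "the trivial
  homomorphism … i.e., the composite of the natural homomorphisms `M^μ_TM(Π) ⊆ M^×_TM(Π) ≅ O^×(G) ↠ O^{×μ}(G)`":
  the composite IS trivial, for every representative of `α_×` (indeed for every homomorphism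
  `M^×_TM(Π) → O^×(G)`: torsion maps to torsion, which dies in `O^×/O^μ`);
* (b) `AbsTopMonoids.ex18v_compatible` / `ex18v_isos_compatible` / `IsoClass.fullPoly_comp_eq_univ` /
  `AbsTopMonoids.fullPoly_quotMap_comp_eq_univ` — "these isomorphisms are compatible with `α_{μ,×μ}`,
  `α*_{μ,×μ}` in the evident sense": the square of the trivial homomorphisms with the induced isomorphisms
  (and any `Γ^{×μ}`-multiple) commutes, and the full poly-isomorphism `Π/Δ ≅ G` composed with any `G ≅ G*`,
  resp. precomposed with the isomorphism `Π/Δ ≅ Π*/Δ*` induced by `Π ≅ Π*` (`AbsTopMonoids.quotMap`), is the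
  full poly-isomorphism;
* (c) `ex18v_full_essSurj` / `ex18v_holds` — "whose associated radial functor is full and essentially
  surjective, hence determines a multiradial environment", at the environment of (v), which has the shape
  `ex18iii S Γ^{×μ}` (`RadialExamples.lean`, section "Example 1.8 (iv)–(ix)").
Nothing here bears on [IUTchIII] Cor. 3.12; typed ≠ endorsed.
-/

namespace Literature.IUT.HodgeArakelov

open CategoryTheory

universe u

variable {S : ThetaSetting.{u}}

/-! ## (b), poly-isomorphism part: full poly-isomorphisms absorb isomorphisms -/

/-- **IUTchII:Ex1.8(v)** (kurims p. 40 l. 7: "compatible with `α_{μ,×μ}`, `α*_{μ,×μ}` in the evident sense"),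
the `Π/Δ ≅ G` component: the full poly-isomorphism `Q ≅ G` (= ALL isomorphisms of topological groups)
followed by an isomorphism `g : G ≅ G*` is the full poly-isomorphism `Q ≅ G*`. PROVED (groupoid).
[claim: Mochizuki2012, status: disputed] (IUTchII §1 Ex 1.8 (v), kurims p.40) -/
theorem IsoClass.fullPoly_comp_eq_univ {P₀ : TopGroup.{u}} (Q G G' : IsoClass P₀) (g : G ⟶ G') :
    Set.range (fun f : Q ⟶ G => f ≫ g) = Set.univ := by
  refine Set.eq_univ_of_forall fun h => ⟨h ≫ Groupoid.inv g, ?_⟩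
  simp only [Category.assoc, Groupoid.inv_comp, Category.comp_id]

/-- **IUTchII:Ex1.8(v)** (kurims p. 40 l. 7), the `Π/Δ ≅ G` component on the `Π`-side: the isomorphism
`Π/Δ ≅ Π*/Δ*` induced by `e : Π ≅ Π*` (`AbsTopMonoids.quotMap`) followed by the full poly-isomorphism
`Π*/Δ* ≅ G` is the full poly-isomorphism `Π/Δ ≅ G`. PROVED (groupoid).
[claim: Mochizuki2012, status: disputed] (IUTchII §1 Ex 1.8 (v), kurims p.40) -/
theorem AbsTopMonoids.fullPoly_quotMap_comp_eq_univ (A : AbsTopMonoids S) {P P' : IsoClass S.PiX}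
    (e : P ⟶ P') (G : IsoClass S.Gk) :
    Set.range (fun f' : (⟨TopGroup.quot P'.G (A.Delta P'), A.quotIso P'⟩ : IsoClass S.Gk) ⟶ G =>
      A.quotMap e ≫ f') = Set.univ := by
  refine Set.eq_univ_of_forall fun h => ⟨Groupoid.inv (A.quotMap e) ≫ h, ?_⟩
  simp only [← Category.assoc, Groupoid.comp_inv, Category.id_comp]

namespace AbsTopMonoids

variable (A : AbsTopMonoids S)

/-! ## (a) the trivial homomorphism `M^μ_TM(Π) → O^{×μ}(G)` -/

/-- **IUTchII:Ex1.8(v)** (kurims p. 39 ll. 41–51), mechanism: ANY homomorphism `φ : M^×_TM(Π) → O^×(G)`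
restricted to the torsion `M^μ_TM(Π)` and followed by `O^×(G) ↠ O^{×μ}(G) = O^×(G)/O^μ(G)` is the trivial
homomorphism (a homomorphism carries torsion into torsion). PROVED.
[claim: Mochizuki2012, status: disputed] (IUTchII §1 Ex 1.8 (v), kurims p.39) -/
theorem ex18v_comp_eq_one (P : IsoClass S.PiX) (G : IsoClass S.Gk) (φ : (A.MTM P)ˣ →* A.Ounits G) :
    (QuotientGroup.mk' (A.Omu G)).comp (φ.comp (CommGroup.torsion (A.MTM P)ˣ).subtype) = 1 := by
  ext m
  simp only [MonoidHom.coe_comp, Function.comp_apply, QuotientGroup.coe_mk', MonoidHom.one_apply,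
    QuotientGroup.eq_one_iff, Subgroup.coe_subtype]
  exact (CommGroup.mem_torsion _).2 (φ.isOfFinOrder ((CommGroup.mem_torsion _).1 m.2))

/-- **IUTchII:Ex1.8(v)** (kurims p. 39 ll. 41–51): "the trivial homomorphism `M^μ_TM(Π) → O^{×μ}(G)` — i.e.,
the composite of the natural homomorphisms `M^μ_TM(Π) ⊆ M^×_TM(Π) ≅ O^×(G) ↠ O^{×μ}(G)` [where the `≅`
arises from the poly-isomorphism `α_×` of (iii)]": for EVERY member `f : Π/Δ ≅ G` of the full
poly-isomorphism, the composite through the representative `Units.map ((*TM⊳) ≫ O^⊳(f))` of `α_×` IS the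
trivial homomorphism. PROVED. [claim: Mochizuki2012, status: disputed] (IUTchII §1 Ex 1.8 (v), kurims p.39) -/
theorem ex18v_trivialHom (P : IsoClass S.PiX) (G : IsoClass S.Gk)
    (f : (⟨TopGroup.quot P.G (A.Delta P), A.quotIso P⟩ : IsoClass S.Gk) ⟶ G) :
    (QuotientGroup.mk' (A.Omu G)).comp
        ((Units.map ((A.tauto P).trans (A.mapOtri f)).toMonoidHom).comp
          (CommGroup.torsion (A.MTM P)ˣ).subtype) = 1 :=
  A.ex18v_comp_eq_one P G _

/-- **IUTchII:Ex1.8(v)** (kurims p. 39 ll. 41–51), pointwise form of `ex18v_trivialHom`: every torsion element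
of `M^×_TM(Π)` is sent to `1 ∈ O^{×μ}(G)` by `M^×_TM(Π) ≅ O^×(G) ↠ O^{×μ}(G)`. PROVED.
[claim: Mochizuki2012, status: disputed] (IUTchII §1 Ex 1.8 (v), kurims p.39) -/
theorem ex18v_trivialHom_apply (P : IsoClass S.PiX) (G : IsoClass S.Gk)
    (f : (⟨TopGroup.quot P.G (A.Delta P), A.quotIso P⟩ : IsoClass S.Gk) ⟶ G)
    (m : (A.MTM P)ˣ) (hm : m ∈ CommGroup.torsion (A.MTM P)ˣ) :
    (QuotientGroup.mk (Units.map ((A.tauto P).trans (A.mapOtri f)).toMonoidHom m) : A.Oxmu G) = 1 := by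
  have h := DFunLike.congr_fun (A.ex18v_trivialHom P G f) ⟨m, hm⟩
  simpa using h

/-! ## (b) compatibility of the isomorphisms of radial data with `α_{μ,×μ}`, `α*_{μ,×μ}` -/

/-- **IUTchII:Ex1.8(v)** (kurims p. 40 ll. 7–9: "[so one verifies immediately that these isomorphisms are
compatible with `α_{μ,×μ}`, `α*_{μ,×μ}` in the evident sense]"), module part, general form: for ANY
homomorphisms `ψ : M^μ_TM(Π) → M^μ_TM(Π*)` and `χ : O^{×μ}(G) → O^{×μ}(G*)` (in particular the induced
isomorphisms and their `Γ^{×μ}`-multiples) the square formed with the trivial homomorphisms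
`M^μ_TM(Π) → O^{×μ}(G)`, `M^μ_TM(Π*) → O^{×μ}(G*)` (through any representatives `φ`, `φ'` of `α_×`, `α*_×`)
commutes. PROVED. [claim: Mochizuki2012, status: disputed] (IUTchII §1 Ex 1.8 (v), kurims p.40) -/
theorem ex18v_compatible (P P' : IsoClass S.PiX) (G G' : IsoClass S.Gk)
    (φ : (A.MTM P)ˣ →* A.Ounits G) (φ' : (A.MTM P')ˣ →* A.Ounits G')
    (ψ : CommGroup.torsion (A.MTM P)ˣ →* CommGroup.torsion (A.MTM P')ˣ) (χ : A.Oxmu G →* A.Oxmu G') :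
    χ.comp ((QuotientGroup.mk' (A.Omu G)).comp (φ.comp (CommGroup.torsion (A.MTM P)ˣ).subtype)) =
      ((QuotientGroup.mk' (A.Omu G')).comp (φ'.comp (CommGroup.torsion (A.MTM P')ˣ).subtype)).comp ψ := by
  rw [A.ex18v_comp_eq_one, A.ex18v_comp_eq_one, MonoidHom.comp_one, MonoidHom.one_comp]

/-- **IUTchII:Ex1.8(v)** (kurims p. 40 ll. 7–9), module part at the printed isomorphisms: for an isomorphism
of radial data — `e : Π ≅ Π*` (inducing `Units.map (A.mapMTM e)` on `M^×_TM`, hence on the torsion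
`M^μ_TM`) and the `γ`-multiple, `γ ∈ Γ^{×μ} ⊆ Ism(G*)`, of the isomorphism `O^{×μ}(G) ≅ O^{×μ}(G*)` induced by
`g : G ≅ G*` — and any members `f : Π/Δ ≅ G`, `f' : Π*/Δ* ≅ G*` of the full poly-isomorphisms, the square
with `α_{μ,×μ}`, `α*_{μ,×μ}` commutes on every element of `M^μ_TM(Π)` (both paths give `1`). PROVED.
[claim: Mochizuki2012, status: disputed] (IUTchII §1 Ex 1.8 (v), kurims p.40) -/
theorem ex18v_isos_compatible {P P' : IsoClass S.PiX} {G G' : IsoClass S.Gk} (e : P ⟶ P') (g : G ⟶ G')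
    (γ : A.Ism G') (f : (⟨TopGroup.quot P.G (A.Delta P), A.quotIso P⟩ : IsoClass S.Gk) ⟶ G)
    (f' : (⟨TopGroup.quot P'.G (A.Delta P'), A.quotIso P'⟩ : IsoClass S.Gk) ⟶ G')
    (m : (A.MTM P)ˣ) (hm : m ∈ CommGroup.torsion (A.MTM P)ˣ) :
    A.actIsm G' γ (MulEquivModTorsion (Units.mapEquiv (A.mapOtri g))
        (QuotientGroup.mk (Units.map ((A.tauto P).trans (A.mapOtri f)).toMonoidHom m) : A.Oxmu G)) =
      (QuotientGroup.mk (Units.map ((A.tauto P').trans (A.mapOtri f')).toMonoidHom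
        (Units.map (A.mapMTM e).toMonoidHom m)) : A.Oxmu G') := by
  have hm' : Units.map (A.mapMTM e).toMonoidHom m ∈ CommGroup.torsion (A.MTM P')ˣ :=
    (CommGroup.mem_torsion _).2
      ((Units.map (A.mapMTM e).toMonoidHom).isOfFinOrder ((CommGroup.mem_torsion _).1 hm))
  rw [A.ex18v_trivialHom_apply P G f m hm, A.ex18v_trivialHom_apply P' G' f' _ hm', map_one, map_one]

end AbsTopMonoids

/-! ## (c) the radial functor of (v) is full and essentially surjective -/

/-- **IUTchII:Ex1.8(v)** (kurims p. 40 ll. 15–19): "The radial algorithm is the algorithm given by the assignment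
`(Π ↷ M^μ_TM(Π), G ↷ O^{×μ}(G), α_{μ,×μ}) ↦ (G ↷ O^{×μ}(G))` — whose associated radial functor is full and
essentially surjective" — at the environment of (v), which (coric data and their isomorphisms "the same as in
the co-cyclotomic version discussed in (iv)") has the shape `ex18iii S Γ^{×μ}` of `RadialExamples.lean`.
PROVED. [claim: Mochizuki2012, status: disputed] (IUTchII §1 Ex 1.8 (v), kurims p.40) -/
theorem ex18v_full_essSurj (S : ThetaSetting.{u}) (Γxμ : Type u) [Group Γxμ] :
    (ex18iii S Γxμ).Φ.Full ∧ (ex18iii S Γxμ).Φ.EssSurj :=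
  ⟨ex18iii_isMultiradial S Γxμ, (ex18iii S Γxμ).essSurj⟩

/-- **IUTchII:Ex1.8(v)** (kurims p. 39 l. 26 – p. 40 l. 19), the node's printed claims in print order:
(a) the composite `M^μ_TM(Π) ⊆ M^×_TM(Π) ≅ O^×(G) ↠ O^{×μ}(G)` is the trivial homomorphism for every member of
the full poly-isomorphism `Π/Δ ≅ G`; (c) the radial functor is full and essentially surjective, "hence
determines a multiradial environment". ((b), the compatibility of isomorphisms of radial data with
`α_{μ,×μ}`, is `AbsTopMonoids.ex18v_compatible` / `ex18v_isos_compatible`.) PROVED.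
[claim: Mochizuki2012, status: disputed] (IUTchII §1 Ex 1.8 (v), kurims pp.39-40) -/
theorem ex18v_holds (S : ThetaSetting.{u}) (A : AbsTopMonoids S) (Γxμ : Type u) [Group Γxμ] :
    (∀ (P : IsoClass S.PiX) (G : IsoClass S.Gk)
        (f : (⟨TopGroup.quot P.G (A.Delta P), A.quotIso P⟩ : IsoClass S.Gk) ⟶ G),
        (QuotientGroup.mk' (A.Omu G)).comp
            ((Units.map ((A.tauto P).trans (A.mapOtri f)).toMonoidHom).comp
              (CommGroup.torsion (A.MTM P)ˣ).subtype) = 1) ∧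
      ((ex18iii S Γxμ).Φ.Full ∧ (ex18iii S Γxμ).Φ.EssSurj) ∧ (ex18iii S Γxμ).IsMultiradial :=
  ⟨fun P G f => A.ex18v_trivialHom P G f, ex18v_full_essSurj S Γxμ, ex18iii_isMultiradial S Γxμ⟩

end Literature.IUT.HodgeArakelov
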